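import Mathlib.Analysis.SpecialFunctions.ExpDeriv
import Mathlib.Analysis.SpecialFunctions.Trigonometric.Basic
import Mathlib.Analysis.Complex.Exponential
import Mathlib.MeasureTheory.Integral.Lebesgue.Countable
import Mathlib.MeasureTheory.Integral.Lebesgue.Add
import Mathlib.Analysis.SpecificLimits.Basic
import HarnessLib

/-!
# Route `CylinderEntropy`, item `ImmortalAreaToFloor` (stmt-SmoothPoincare4-17197):
# elementary Gaussian bookkeeping, II: Gaussians from balls by dyadic shells (module Γ3 of
# `BLUEPRINT-17197-c2.md`)

Pure measure theory: for a measure `β`, a measurable "distance" `d : α → ℝ` and the backward heat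
kernel profile `G_s = exp(-d²/(4s))/(4πs)²` of `ℝ⁴`:
* `shell_term_le` — `16^k e^{-4^k/16} ≤ 24576 · 4^{-k}`;
* `lintegral_gaussian_le_of_quartic_growth` — if `β{d ≤ r} ≤ Λ r⁴` for `0 < r ≤ R₀` then
  `∫ G_s dβ ≤ 2048 e^{1/16} Λ / π² + (4πs)⁻² e^{-R₀²/(4s)} β(univ)`.
This converts BALL information (relative smallness of `|H|²dμ` on all balls up to radius `R₀` at a
good point, quartic upper density from the entropy bound) into GAUSSIAN-weighted bounds uniform in
the scale, as needed by the weighted Gaussian monotonicity at good points.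

References: W. K. Allard, Ann. of Math. 95 (1972) §6; L. Simon, *Lectures on GMT* (1983) §17.
-/

noncomputable section

-- the prescribed namespace `Summit.SmoothPoincare4.SmoothPoincare4.…` repeats `SmoothPoincare4`
set_option linter.dupNamespace false

open MeasureTheory Set Filter Real
open scoped ENNReal NNReal Topology BigOperators

namespace Summit.SmoothPoincare4.SmoothPoincare4.Theorems.GaussianBounds

variable {α : Type*} [MeasurableSpace α]

/-! ## Gaussians from balls: dyadic shells -/

/-- The numerical engine of the shell bound: `16^k e^{-4^k/16} ≤ 24576 · 4^{-k}` for every `k`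
(`e^x ≥ x³/6` at `x = 4^k/16`, and `64^k = 16^k 4^k`). [folklore] -/
theorem shell_term_le (k : ℕ) :
    (16 : ℝ) ^ k * Real.exp (-((4 : ℝ) ^ k / 16)) ≤ 24576 * ((1 / 4 : ℝ) ^ k) := by
  have hx : 0 ≤ (4 : ℝ) ^ k / 16 := by positivity
  have h3 := Real.pow_div_factorial_le_exp ((4 : ℝ) ^ k / 16) hx 3
  have hfac : ((Nat.factorial 3 : ℕ) : ℝ) = 6 := by norm_num [Nat.factorial]
  rw [hfac] at h3
  -- `((4^k)/16)^3 / 6 = 64^k / 24576`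
  have h64 : ((4 : ℝ) ^ k / 16) ^ 3 / 6 = (64 : ℝ) ^ k / 24576 := by
    rw [div_pow, ← pow_mul, show (4 : ℝ) ^ (k * 3) = 64 ^ k by
      rw [mul_comm, pow_mul]; norm_num]
    ring
  rw [h64] at h3
  have hexp0 : 0 < Real.exp ((4 : ℝ) ^ k / 16) := Real.exp_pos _
  have h64k : (64 : ℝ) ^ k = 16 ^ k * 4 ^ k := by
    rw [← mul_pow]; norm_num
  rw [Real.exp_neg]
  have h4k : 0 < (4 : ℝ) ^ k := by positivity
  rw [one_div, inv_pow]
  -- `16^k / e^{x} ≤ 24576 / 4^k` iff `16^k 4^k ≤ 24576 e^x`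
  rw [← div_eq_mul_inv, ← div_eq_mul_inv, div_le_div_iff₀ hexp0 h4k]
  calc (16 : ℝ) ^ k * 4 ^ k = 64 ^ k := h64k.symm
    _ ≤ 24576 * Real.exp ((4 : ℝ) ^ k / 16) := by
        rw [div_le_iff₀ (by norm_num : (0 : ℝ) < 24576)] at h3
        linarith

/-- **Gaussian mass from quartic ball growth (dyadic shells).**  Let `β` be a measure, `d`
measurable, `0 < s`, `0 < R₀`, `0 ≤ Λ`, and suppose `β{d ≤ r} ≤ Λ r⁴` for every `0 < r ≤ R₀`.  Then
`∫ G_s dβ ≤ 2048 e^{1/16} Λ / π² + (4πs)⁻² e^{-R₀²/(4s)} β(univ)`, `G_s = e^{-d²/(4s)}/(4πs)²`.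
Proof: on `{d ≤ R₀}` bound `G_s` pointwise by `(4πs)⁻² e^{1/16} e^{-4^j/16}` on the `j`-th dyadic shell
`2^{j-1}√s < d ≤ 2^j √s`, integrate shell by shell (`β{d ≤ 2^j √s ∧ d ≤ R₀} ≤ Λ 16^j s²`) and sum
`16^j e^{-4^j/16} ≤ 24576·4^{-j}` (`shell_term_le`); on `{R₀ < d}` bound `G_s` by its value at `R₀`.
[cite: Allard1972, §6] -/
theorem lintegral_gaussian_le_of_quartic_growth (β : Measure α) {d : α → ℝ} (hd : Measurable d)
    {s R₀ Λ : ℝ} (hs : 0 < s) (hR₀ : 0 < R₀) (hΛ : 0 ≤ Λ)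
    (hgrowth : ∀ r, 0 < r → r ≤ R₀ → β {a | d a ≤ r} ≤ ENNReal.ofReal (Λ * r ^ 4)) :
    ∫⁻ a, ENNReal.ofReal (Real.exp (-(d a) ^ 2 / (4 * s)) / (4 * Real.pi * s) ^ 2) ∂β ≤
      ENNReal.ofReal (2048 * Real.exp (1 / 16) * Λ / Real.pi ^ 2) +
        ENNReal.ofReal (Real.exp (-R₀ ^ 2 / (4 * s)) / (4 * Real.pi * s) ^ 2) * β univ := by
  have hπ := Real.pi_pos
  have hss : 0 < Real.sqrt s := Real.sqrt_pos.2 hs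
  have hsq : Real.sqrt s ^ 2 = s := Real.sq_sqrt hs.le
  -- dyadic radii and shell sets
  set ρ : ℕ → ℝ := fun k => 2 ^ k * Real.sqrt s with hρ
  have hρpos : ∀ k, 0 < ρ k := fun k => by positivity
  set S : ℕ → Set α := fun k => {a | d a ≤ min (ρ k) R₀} with hS
  have hSm : ∀ k, MeasurableSet (S k) := fun k => measurableSet_le hd measurable_const
  -- the shell weights
  set c₀ : ℝ := 1 / (4 * Real.pi * s) ^ 2 with hc₀
  have hc₀pos : 0 < c₀ := by positivity
  set w : ℕ → ℝ := fun k => c₀ * Real.exp (1 / 16) * Real.exp (-((4 : ℝ) ^ k / 16)) with hw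
  have hwpos : ∀ k, 0 ≤ w k := fun k => by positivity
  -- pointwise domination on `{d ≤ R₀}`
  have hpt : ∀ a, d a ≤ R₀ →
      ENNReal.ofReal (Real.exp (-(d a) ^ 2 / (4 * s)) / (4 * Real.pi * s) ^ 2) ≤
        ∑' k, ENNReal.ofReal (w k) * (S k).indicator 1 a := by
    intro a haR
    -- the first dyadic radius beyond `d a`
    have hex : ∃ k : ℕ, d a ≤ ρ k := by
      obtain ⟨k, hk⟩ := pow_unbounded_of_one_lt (d a / Real.sqrt s) (by norm_num : (1 : ℝ) < 2)
      exact ⟨k, by rw [hρ]; rw [div_lt_iff₀ hss] at hk; exact hk.le⟩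
    classical
    set j := Nat.find hex with hj
    have hj1 : d a ≤ ρ j := Nat.find_spec hex
    have haS : a ∈ S j := by
      show d a ≤ min (ρ j) R₀
      exact le_min hj1 haR
    -- the kernel at `a` is at most `w j`
    have hker : Real.exp (-(d a) ^ 2 / (4 * s)) / (4 * Real.pi * s) ^ 2 ≤ w j := by
      have hform : Real.exp (-(d a) ^ 2 / (4 * s)) / (4 * Real.pi * s) ^ 2 =
          c₀ * Real.exp (-(d a) ^ 2 / (4 * s)) := by rw [hc₀]; ring
      rw [hform]
      show _ ≤ c₀ * Real.exp (1 / 16) * Real.exp (-((4 : ℝ) ^ j / 16))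
      rw [mul_assoc]
      refine mul_le_mul_of_nonneg_left ?_ hc₀pos.le
      rw [← Real.exp_add]
      apply Real.exp_le_exp.2
      rcases Nat.eq_zero_or_pos j with hj0 | hjpos
      · -- `j = 0`: `-(d a)²/(4s) ≤ 0 ≤ 1/16 - 1/16`
        rw [hj0, pow_zero]
        have : 0 ≤ (d a) ^ 2 / (4 * s) := by positivity
        have h' : -(d a) ^ 2 / (4 * s) = -((d a) ^ 2 / (4 * s)) := by ring
        rw [h']
        linarith
      · -- `j ≥ 1`: `ρ (j-1) < d a`, so `(d a)²/(4s) > 4^(j-1)/4 = 4^j/16`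
        have hlt : ρ (j - 1) < d a :=
          not_le.1 (Nat.find_min hex (show j - 1 < j by omega))
        have hρj : ρ (j - 1) ^ 2 = (4 : ℝ) ^ j / 4 * s := by
          rw [hρ]
          simp only
          rw [mul_pow, ← pow_mul, hsq]
          have : (2 : ℝ) ^ ((j - 1) * 2) = 4 ^ j / 4 := by
            rw [pow_mul, show (2 : ℝ) ^ (j - 1) = 2 ^ j / 2 by
              rw [← Nat.sub_add_cancel hjpos, pow_succ]; simp]
            rw [div_pow, ← pow_mul, show (2:ℝ) ^ (j * 2) = 4 ^ j by rw [mul_comm, pow_mul]; norm_num]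
            norm_num
          rw [this]
        have h1 : ρ (j - 1) ^ 2 < (d a) ^ 2 := by
          exact pow_lt_pow_left₀ hlt (hρpos _).le two_ne_zero
        rw [hρj] at h1
        have h2 : (4 : ℝ) ^ j / 16 < (d a) ^ 2 / (4 * s) := by
          rw [lt_div_iff₀ (by positivity)]
          nlinarith
        have h' : -(d a) ^ 2 / (4 * s) = -((d a) ^ 2 / (4 * s)) := by ring
        rw [h']
        linarith
    calc ENNReal.ofReal (Real.exp (-(d a) ^ 2 / (4 * s)) / (4 * Real.pi * s) ^ 2)
        ≤ ENNReal.ofReal (w j) := ENNReal.ofReal_le_ofReal hker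
      _ = ENNReal.ofReal (w j) * (S j).indicator 1 a := by
          rw [indicator_of_mem haS, Pi.one_apply, mul_one]
      _ ≤ ∑' k, ENNReal.ofReal (w k) * (S k).indicator 1 a :=
          ENNReal.le_tsum j
  -- integrate the domination over `{d ≤ R₀}`
  have hnear : ∫⁻ a in {a | d a ≤ R₀}, ENNReal.ofReal (Real.exp (-(d a) ^ 2 / (4 * s)) /
      (4 * Real.pi * s) ^ 2) ∂β ≤ ∑' k, ENNReal.ofReal (w k) * β (S k) := by
    have hmR : MeasurableSet {a | d a ≤ R₀} := measurableSet_le hd measurable_const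
    calc ∫⁻ a in {a | d a ≤ R₀}, ENNReal.ofReal (Real.exp (-(d a) ^ 2 / (4 * s)) /
          (4 * Real.pi * s) ^ 2) ∂β
        ≤ ∫⁻ a in {a | d a ≤ R₀}, ∑' k, ENNReal.ofReal (w k) * (S k).indicator 1 a ∂β :=
          setLIntegral_mono' hmR fun a ha => hpt a ha
      _ ≤ ∫⁻ a, ∑' k, ENNReal.ofReal (w k) * (S k).indicator 1 a ∂β := setLIntegral_le_lintegral _ _
      _ = ∑' k, ∫⁻ a, ENNReal.ofReal (w k) * (S k).indicator 1 a ∂β := by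
          rw [lintegral_tsum]
          intro k
          exact (measurable_const.mul (measurable_one.indicator (hSm k))).aemeasurable
      _ = ∑' k, ENNReal.ofReal (w k) * β (S k) := by
          congr 1 with k
          rw [lintegral_const_mul _ (measurable_one.indicator (hSm k)), lintegral_indicator_one (hSm k)]
  -- each shell: `w k · β(S k) ≤ (c₀ e^{1/16} Λ s²) · 24576 · 4^{-k}`
  have hshell : ∀ k, ENNReal.ofReal (w k) * β (S k) ≤
      ENNReal.ofReal (c₀ * Real.exp (1 / 16) * Λ * s ^ 2 * 24576) * (1 / 4 : ℝ≥0∞) ^ k := by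
    intro k
    have hmin : 0 < min (ρ k) R₀ := lt_min (hρpos k) hR₀
    have hβ : β (S k) ≤ ENNReal.ofReal (Λ * (min (ρ k) R₀) ^ 4) :=
      hgrowth _ hmin (min_le_right _ _)
    have hmin4 : (min (ρ k) R₀) ^ 4 ≤ (ρ k) ^ 4 := pow_le_pow_left₀ hmin.le (min_le_left _ _) 4
    have hρ4 : (ρ k) ^ 4 = (16 : ℝ) ^ k * s ^ 2 := by
      rw [hρ]
      simp only
      rw [mul_pow, ← pow_mul, show Real.sqrt s ^ 4 = (Real.sqrt s ^ 2) ^ 2 by ring, hsq,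
        show (2 : ℝ) ^ (k * 4) = 16 ^ k by rw [mul_comm, pow_mul]; norm_num]
    calc ENNReal.ofReal (w k) * β (S k)
        ≤ ENNReal.ofReal (w k) * ENNReal.ofReal (Λ * (ρ k) ^ 4) := by
          gcongr
          exact hβ.trans (ENNReal.ofReal_le_ofReal (mul_le_mul_of_nonneg_left hmin4 hΛ))
      _ = ENNReal.ofReal (c₀ * Real.exp (1 / 16) * Λ * s ^ 2 *
            ((16 : ℝ) ^ k * Real.exp (-((4 : ℝ) ^ k / 16)))) := by
          rw [← ENNReal.ofReal_mul (hwpos k), hρ4, hw]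
          ring_nf
      _ ≤ ENNReal.ofReal (c₀ * Real.exp (1 / 16) * Λ * s ^ 2 * (24576 * (1 / 4 : ℝ) ^ k)) := by
          apply ENNReal.ofReal_le_ofReal
          exact mul_le_mul_of_nonneg_left (shell_term_le k) (by positivity)
      _ = ENNReal.ofReal (c₀ * Real.exp (1 / 16) * Λ * s ^ 2 * 24576) * (1 / 4 : ℝ≥0∞) ^ k := by
          rw [show c₀ * Real.exp (1 / 16) * Λ * s ^ 2 * (24576 * (1 / 4 : ℝ) ^ k) =
            (c₀ * Real.exp (1 / 16) * Λ * s ^ 2 * 24576) * (1 / 4 : ℝ) ^ k by ring,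
            ENNReal.ofReal_mul (by positivity), ENNReal.ofReal_pow (by norm_num),
            ENNReal.ofReal_div_of_pos (by norm_num : (0:ℝ) < 4), ENNReal.ofReal_one]
          norm_num
  -- sum the geometric series: `∑ 4^{-k} = 4/3`
  have hgeom : ∑' k : ℕ, (1 / 4 : ℝ≥0∞) ^ k = 4 / 3 := by
    rw [ENNReal.tsum_geometric]
    have h34 : (1 : ℝ≥0∞) - 1 / 4 = 3 / 4 := by
      have h1 : (3 / 4 : ℝ≥0∞) + 1 / 4 = 1 := by
        rw [ENNReal.div_add_div_same, show (3 : ℝ≥0∞) + 1 = 4 by norm_num,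
          ENNReal.div_self (by norm_num) (by norm_num)]
      exact ENNReal.sub_eq_of_eq_add (by norm_num) h1.symm
    rw [h34, ENNReal.inv_div (Or.inr (by norm_num)) (Or.inr (by norm_num))]
  have hsum : ∑' k, ENNReal.ofReal (w k) * β (S k) ≤
      ENNReal.ofReal (c₀ * Real.exp (1 / 16) * Λ * s ^ 2 * 24576) * (4 / 3) := by
    calc ∑' k, ENNReal.ofReal (w k) * β (S k)
        ≤ ∑' k, ENNReal.ofReal (c₀ * Real.exp (1 / 16) * Λ * s ^ 2 * 24576) * (1 / 4 : ℝ≥0∞) ^ k :=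
          ENNReal.tsum_le_tsum hshell
      _ = ENNReal.ofReal (c₀ * Real.exp (1 / 16) * Λ * s ^ 2 * 24576) * ∑' k : ℕ, (1 / 4 : ℝ≥0∞) ^ k :=
          ENNReal.tsum_mul_left
      _ = _ := by rw [hgeom]
  -- identify the constant: `c₀ s² 24576 (4/3) = 2048/π²`
  have hconst : ENNReal.ofReal (c₀ * Real.exp (1 / 16) * Λ * s ^ 2 * 24576) * (4 / 3) =
      ENNReal.ofReal (2048 * Real.exp (1 / 16) * Λ / Real.pi ^ 2) := by
    rw [show (4 / 3 : ℝ≥0∞) = ENNReal.ofReal (4 / 3) by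
      rw [ENNReal.ofReal_div_of_pos (by norm_num : (0:ℝ) < 3)]; norm_num,
      ← ENNReal.ofReal_mul (by positivity)]
    congr 1
    rw [hc₀]
    field_simp
    ring
  -- the far region `{R₀ < d}`
  have hfar : ∫⁻ a in {a | R₀ < d a}, ENNReal.ofReal (Real.exp (-(d a) ^ 2 / (4 * s)) /
      (4 * Real.pi * s) ^ 2) ∂β ≤
      ENNReal.ofReal (Real.exp (-R₀ ^ 2 / (4 * s)) / (4 * Real.pi * s) ^ 2) * β univ := by
    have hmR : MeasurableSet {a | R₀ < d a} := measurableSet_lt measurable_const hd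
    calc ∫⁻ a in {a | R₀ < d a}, ENNReal.ofReal (Real.exp (-(d a) ^ 2 / (4 * s)) /
          (4 * Real.pi * s) ^ 2) ∂β
        ≤ ∫⁻ _ in {a | R₀ < d a}, ENNReal.ofReal (Real.exp (-R₀ ^ 2 / (4 * s)) /
            (4 * Real.pi * s) ^ 2) ∂β := by
          refine setLIntegral_mono' hmR fun a ha => ENNReal.ofReal_le_ofReal ?_
          refine div_le_div_of_nonneg_right (Real.exp_le_exp.2 ?_) (by positivity)
          have h1 : R₀ ^ 2 ≤ (d a) ^ 2 := pow_le_pow_left₀ hR₀.le (le_of_lt ha) 2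
          rw [neg_div, neg_div, neg_le_neg_iff]
          exact div_le_div_of_nonneg_right h1 (by positivity)
      _ = ENNReal.ofReal (Real.exp (-R₀ ^ 2 / (4 * s)) / (4 * Real.pi * s) ^ 2) *
            β {a | R₀ < d a} := by rw [setLIntegral_const, mul_comm]
      _ ≤ _ := by gcongr; exact subset_univ _
  -- split the integral
  have hsplit : ∫⁻ a, ENNReal.ofReal (Real.exp (-(d a) ^ 2 / (4 * s)) / (4 * Real.pi * s) ^ 2) ∂β =
      ∫⁻ a in {a | d a ≤ R₀}, ENNReal.ofReal (Real.exp (-(d a) ^ 2 / (4 * s)) /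
          (4 * Real.pi * s) ^ 2) ∂β +
        ∫⁻ a in {a | R₀ < d a}, ENNReal.ofReal (Real.exp (-(d a) ^ 2 / (4 * s)) /
          (4 * Real.pi * s) ^ 2) ∂β := by
    have hmR : MeasurableSet {a | d a ≤ R₀} := measurableSet_le hd measurable_const
    have hcompl : {a | R₀ < d a} = {a | d a ≤ R₀}ᶜ := by
      ext a; simp [not_le]
    rw [hcompl, lintegral_add_compl _ hmR]
  rw [hsplit]
  exact add_le_add (hnear.trans (hsum.trans hconst.le)) hfar

end Summit.SmoothPoincare4.SmoothPoincare4.Theorems.GaussianBounds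

end
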